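import Mathlib
import Summits.QuantumFields.QCD.Theses.PauliWegnerSea
import Literature.MathematicalPhysics.QuantumFieldTheory.QCDHeavyQuarkPropagator
import Literature.MathematicalPhysics.QuantumFieldTheory.QCDWickMinorMeasurability
import Literature.MathematicalPhysics.QuantumFieldTheory.QCDPhaseQuenchedPositivity

/-!
# The constant-regularisation dictionary

Crux `stmt-QuantumFields-9151` (`PhaseQuenchedFlavourDecay`), line crossing-split-integrability.
`QCDRegularisation Nf` constrains only `a_k > 0`, `a_k → 0`, `a_k L_k → ∞` and `Z_m(k) > 0`;
the bare coupling `β_k`, the critical mass `m_crit(k)` and the scale `a_k / Z_m(k)` are free. Hence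
every constant lattice parameter point `(β, c, λ)`, `λ > 0`, is realised by an admissible
regularisation (`stub_existsConstRegularisation`), along which the bare masses are the constant
tuple `c + λ m`. Along such a regularisation the crux's hypothesis UPPER (fractional-moment decay at
rate `δ a_k` in lattice units, eventually in `k`, volumes `≥ L_k`) is equivalent to plain exponential
fractional-moment decay at the point at SOME lattice rate on all large volumes
(`stub_upperConstIff`), and its conclusion CONC is equivalent to exponential clustering of every
flavour-charged channel at the point, each at its own rate and amplitude (`stub_concConstIff`).
Both equivalences are pure bookkeeping: `→` evaluates the eventual statement at one late `k`
(rate `δ a_k > 0`, threshold `L_k`); `←` uses `a_k → 0` (so `a_k ≤ μ` eventually, and the fixed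
rate `μ` dominates `1 · a_k`) and `L_k → ∞` (so the volume threshold `S₀` is eventually below `L_k`).
-/

noncomputable section

namespace Summit.QuantumFields.QCD.Cruxes.PhaseQuenchedFlavourDecay.CrossingSplitIntegrability

open scoped BigOperators
open MeasureTheory Filter
open Literature.MathematicalPhysics.QuantumFieldTheory Literature.MathematicalPhysics.QuantumLattice
  Literature.Probability.LatticeModels

/-- W3a: existence of constant-parameter regularisations. Spacings `a_k = 1/(k+1)`, volumes
`L_k = (k+1)²` (borrowed from `SpeciesScheme.zero`), constant `β_k = β`, `m_crit(k) = c`, and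
`Z_m(k) = a_k / λ > 0`, so that `a_k / Z_m(k) = λ`. -/
theorem stub_existsConstRegularisation :
    ∀ (Nf : ℕ) (β c lam : ℝ), 0 < lam → ∃ reg : QCDRegularisation Nf, (∀ k, reg.β k = β) ∧ (∀ k, reg.mcrit k = c) ∧ (∀ k, reg.a k / reg.Zm k = lam) := by
  intro Nf β c lam hlam
  exact ⟨{ a := (SpeciesScheme.zero Unit).a
           a_pos := (SpeciesScheme.zero Unit).a_pos
           tendsto_a := (SpeciesScheme.zero Unit).tendsto_a
           β := fun _ => β
           L := (SpeciesScheme.zero Unit).L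
           tendsto_L := (SpeciesScheme.zero Unit).tendsto_L
           mcrit := fun _ => c
           Zm := fun k => (SpeciesScheme.zero Unit).a k / lam
           Zm_pos := fun k => div_pos ((SpeciesScheme.zero Unit).a_pos k) hlam },
    fun _ => rfl, fun _ => rfl, fun k => div_div_cancel₀ ((SpeciesScheme.zero Unit).a_pos k).ne'⟩

/-- Along any regularisation the volumes eventually exceed any fixed threshold: `L_k → ∞`, because
`a_k L_k → ∞` while `a_k → 0` (so `a_k ≤ 1`, `a_k L_k ≤ L_k` eventually). -/
private theorem eventually_le_L {Nf : ℕ} (reg : QCDRegularisation Nf) (S₀ : ℕ) :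
    ∀ᶠ k in atTop, S₀ ≤ reg.L k := by
  have ha : ∀ᶠ k in atTop, reg.a k ≤ 1 := reg.tendsto_a.eventually_le_const one_pos
  have hL : Tendsto (fun k => (reg.L k : ℝ)) atTop atTop := by
    refine tendsto_atTop_mono' atTop ?_ reg.tendsto_L
    filter_upwards [ha] with k hk
    calc reg.a k * reg.L k ≤ 1 * reg.L k := mul_le_mul_of_nonneg_right hk (Nat.cast_nonneg _)
      _ = reg.L k := one_mul _
  exact (tendsto_natCast_atTop_iff.mp hL).eventually_ge_atTop S₀

/-- At a constant-parameter regularisation the bare mass tuple is the constant tuple `c + λ m`. -/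
private theorem mq_const_eq {Nf : ℕ} (reg : QCDRegularisation Nf) (m : Fin Nf → ℝ) (c lam : ℝ)
    (h2 : ∀ k, reg.mcrit k = c) (h3 : ∀ k, reg.a k / reg.Zm k = lam) (k : ℕ) :
    (fun fl => reg.mcrit k + reg.a k * m fl / reg.Zm k) = fun fl => c + lam * m fl := by
  funext fl
  rw [h2 k, mul_div_right_comm, h3 k]

/-- Abstract form of `stub_upperConstIff`: for a `k`-independent family of quantities
`Ψk k = Ψ`, "eventually in `k`, decay at rate `δ a_k` on volumes `≥ L_k`" is equivalent to
"decay at some rate `μ > 0` on all volumes `≥ S₀`". -/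
private theorem upper_core {Nf : ℕ} (reg : QCDRegularisation Nf)
    (Ψk : ℕ → ℝ → ℕ → Fin Nf → Literature.Probability.LatticeModels.Site 4 → ℝ)
    (Ψ : ℝ → ℕ → Fin Nf → Literature.Probability.LatticeModels.Site 4 → ℝ)
    (hΨ : ∀ k s S f v, Ψk k s S f v = Ψ s S f v) :
    (∃ s δ C : ℝ, 0 < s ∧ s < 1 ∧ 0 < δ ∧ ∀ᶠ k in atTop, ∀ S : ℕ, reg.L k ≤ S →
        ∀ (f : Fin Nf) (v : Literature.Probability.LatticeModels.Site 4), v ∈ box 4 S →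
          Ψk k s S f v ≤ C * Real.exp (-(δ * (reg.a k * ‖v‖)))) ↔
      (∃ s C μ : ℝ, 0 < s ∧ s < 1 ∧ 0 < μ ∧ ∃ S₀ : ℕ, ∀ S : ℕ, S₀ ≤ S →
        ∀ (f : Fin Nf) (v : Literature.Probability.LatticeModels.Site 4), v ∈ box 4 S →
          Ψ s S f v ≤ C * Real.exp (-(μ * ‖v‖))) := by
  constructor
  · rintro ⟨s, δ, C, hs, hs1, hδ, hev⟩
    obtain ⟨k, hk⟩ := hev.exists
    refine ⟨s, C, δ * reg.a k, hs, hs1, mul_pos hδ (reg.a_pos k), reg.L k, fun S hS f v hv => ?_⟩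
    calc Ψ s S f v = Ψk k s S f v := (hΨ k s S f v).symm
      _ ≤ C * Real.exp (-(δ * (reg.a k * ‖v‖))) := hk S hS f v hv
      _ = C * Real.exp (-(δ * reg.a k * ‖v‖)) := by rw [mul_assoc]
  · rintro ⟨s, C, μ, hs, hs1, hμ, S₀, h⟩
    refine ⟨s, 1, max C 0, hs, hs1, one_pos, ?_⟩
    filter_upwards [reg.tendsto_a.eventually_le_const hμ, eventually_le_L reg S₀] with k hk hkL S hS
      f v hv
    rw [hΨ, one_mul]
    calc Ψ s S f v ≤ C * Real.exp (-(μ * ‖v‖)) := h S (hkL.trans hS) f v hv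
      _ ≤ max C 0 * Real.exp (-(μ * ‖v‖)) :=
          mul_le_mul_of_nonneg_right (le_max_left C 0) (Real.exp_nonneg _)
      _ ≤ max C 0 * Real.exp (-(reg.a k * ‖v‖)) :=
          mul_le_mul_of_nonneg_left (Real.exp_le_exp.2
            (neg_le_neg (mul_le_mul_of_nonneg_right hk (norm_nonneg v)))) (le_max_right C 0)

/-- Abstract form of `stub_concConstIff`: for a `k`-independent family of correlations
`Ξk k = Ξ` and a charge predicate `P`, "one rate `δ'`, and for every charged pair an amplitude with,
eventually in `k`, decay at rate `δ' a_k` on volumes `≥ L_k`" is equivalent to "every charged pair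
clusters at its own rate `μ' > 0` and amplitude on all volumes `≥ S₀`". -/
private theorem conc_core {Nf : ℕ} (reg : QCDRegularisation Nf)
    (P : ∀ R : ℕ, QCDLatticeObservable Nf R → Prop)
    (Ξk : ℕ → ∀ R R' : ℕ, QCDLatticeObservable Nf R → QCDLatticeObservable Nf R' → ℕ → ℕ → ℂ)
    (Ξ : ∀ R R' : ℕ, QCDLatticeObservable Nf R → QCDLatticeObservable Nf R' → ℕ → ℕ → ℂ)
    (hΞ : ∀ k R R' A B S n, Ξk k R R' A B S n = Ξ R R' A B S n) :
    (∃ δ' : ℝ, 0 < δ' ∧ ∀ (R R' : ℕ) (A : QCDLatticeObservable Nf R) (B : QCDLatticeObservable Nf R'),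
        P R A → ∃ C' : ℝ, ∀ᶠ k in atTop, ∀ S : ℕ, reg.L k ≤ S → ∀ n : ℕ, n ≤ S →
          ‖Ξk k R R' A B S n‖ ≤ C' * Real.exp (-(δ' * (reg.a k * n)))) ↔
      (∀ (R R' : ℕ) (A : QCDLatticeObservable Nf R) (B : QCDLatticeObservable Nf R'), P R A →
        ∃ C' μ' : ℝ, 0 < μ' ∧ ∃ S₀ : ℕ, ∀ S : ℕ, S₀ ≤ S → ∀ n : ℕ, n ≤ S →
          ‖Ξ R R' A B S n‖ ≤ C' * Real.exp (-(μ' * n))) := by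
  constructor
  · rintro ⟨δ', hδ', h⟩ R R' A B hA
    obtain ⟨C', hev⟩ := h R R' A B hA
    obtain ⟨k, hk⟩ := hev.exists
    refine ⟨C', δ' * reg.a k, mul_pos hδ' (reg.a_pos k), reg.L k, fun S hS n hn => ?_⟩
    calc ‖Ξ R R' A B S n‖ = ‖Ξk k R R' A B S n‖ := by rw [hΞ]
      _ ≤ C' * Real.exp (-(δ' * (reg.a k * n))) := hk S hS n hn
      _ = C' * Real.exp (-(δ' * reg.a k * n)) := by rw [mul_assoc]
  · intro h
    refine ⟨1, one_pos, fun R R' A B hA => ?_⟩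
    obtain ⟨C', μ', hμ', S₀, hb⟩ := h R R' A B hA
    refine ⟨max C' 0, ?_⟩
    filter_upwards [reg.tendsto_a.eventually_le_const hμ', eventually_le_L reg S₀] with k hk hkL S hS
      n hn
    rw [hΞ, one_mul]
    calc ‖Ξ R R' A B S n‖ ≤ C' * Real.exp (-(μ' * n)) := hb S (hkL.trans hS) n hn
      _ ≤ max C' 0 * Real.exp (-(μ' * n)) :=
          mul_le_mul_of_nonneg_right (le_max_left C' 0) (Real.exp_nonneg _)
      _ ≤ max C' 0 * Real.exp (-(reg.a k * n)) :=
          mul_le_mul_of_nonneg_left (Real.exp_le_exp.2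
            (neg_le_neg (mul_le_mul_of_nonneg_right hk (Nat.cast_nonneg n)))) (le_max_right C' 0)

/-- W3b: at a constant-parameter regularisation, UPPER is exponential fractional-moment decay at
the point `(β, c + λ m)`: `→` evaluates UPPER at one late `k` (rate `μ = δ a_k`, threshold `S₀ = L_k`);
`←` takes `δ = 1` and uses `a_k ≤ μ`, `S₀ ≤ L_k` eventually. -/
theorem stub_upperConstIff :
    ∀ (Nf : ℕ) (reg : QCDRegularisation Nf) (m : Fin Nf → ℝ) (β c lam : ℝ), (∀ k, reg.β k = β) → (∀ k, reg.mcrit k = c) → (∀ k, reg.a k / reg.Zm k = lam) →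
      ((∃ s δ C : ℝ, 0 < s ∧ s < 1 ∧ 0 < δ ∧ ∀ᶠ k in atTop, ∀ S : ℕ, reg.L k ≤ S → ∀ (f : Fin Nf) (v : Literature.Probability.LatticeModels.Site 4), v ∈ box 4 S → (∫ U : GaugeConfig 4 (2 * S + 1) (Matrix.specialUnitaryGroup (Fin 3) ℂ), ‖(diracMatrix U fun fl => reg.mcrit k + reg.a k * m fl / reg.Zm k).det‖ * (∑ a : Fin 3, ∑ i : Fin 4, ∑ b : Fin 3, ∑ j : Fin 4, ‖(diracMatrix U fun fl => reg.mcrit k + reg.a k * m fl / reg.Zm k)⁻¹ (quarkEquiv (f, (Torus.proj (2 * S + 1) 0, a, i))) (quarkEquiv (f, (Torus.proj (2 * S + 1) (v), b, j)))‖) ^ s ∂(wilsonMeasure (fundamentalRep (Fin 3)) (reg.β k))) / (∫ U : GaugeConfig 4 (2 * S + 1) (Matrix.specialUnitaryGroup (Fin 3) ℂ), ‖(diracMatrix U fun fl => reg.mcrit k + reg.a k * m fl / reg.Zm k).det‖ ∂(wilsonMeasure (fundamentalRep (Fin 3)) (reg.β k))) ≤ C * Real.exp (-(δ * (reg.a k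 * ‖v‖)))) ↔
        (∃ s C μ : ℝ, 0 < s ∧ s < 1 ∧ 0 < μ ∧ ∃ S₀ : ℕ, ∀ S : ℕ, S₀ ≤ S → ∀ (f : Fin Nf) (v : Literature.Probability.LatticeModels.Site 4), v ∈ box 4 S → (∫ U : GaugeConfig 4 (2 * S + 1) (Matrix.specialUnitaryGroup (Fin 3) ℂ), ‖(diracMatrix U fun fl => c + lam * m fl).det‖ * (∑ a : Fin 3, ∑ i : Fin 4, ∑ b : Fin 3, ∑ j : Fin 4, ‖(diracMatrix U fun fl => c + lam * m fl)⁻¹ (quarkEquiv (f, (Torus.proj (2 * S + 1) 0, a, i))) (quarkEquiv (f, (Torus.proj (2 * S + 1) (v), b, j)))‖) ^ s ∂(wilsonMeasure (fundamentalRep (Fin 3)) β)) / (∫ U : GaugeConfig 4 (2 * S + 1) (Matrix.specialUnitaryGroup (Fin 3) ℂ), ‖(diracMatrix U fun fl => c + lam * m fl).det‖ ∂(wilsonMeasure (fundamentalRep (Fin 3)) β)) ≤ C * Real.exp (-(μ * ‖v‖)))) := by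
  intro Nf reg m β c lam h1 h2 h3
  refine upper_core reg _ _ fun k s S f v => ?_
  rw [h1 k, mq_const_eq reg m c lam h2 h3 k]

/-- W3c: at a constant-parameter regularisation, CONC is exponential clustering of every
flavour-charged channel at the point `(β, c + λ m)`: `→` evaluates CONC at one late `k` (rate
`μ' = δ' a_k`, threshold `S₀ = L_k`); `←` takes `δ' = 1`, amplitude `max C' 0`, and uses `a_k ≤ μ'`,
`S₀ ≤ L_k` eventually. -/
theorem stub_concConstIff :
    ∀ (Nf : ℕ) (reg : QCDRegularisation Nf) (m : Fin Nf → ℝ) (β c lam : ℝ), (∀ k, reg.β k = β) → (∀ k, reg.mcrit k = c) → (∀ k, reg.a k / reg.Zm k = lam) →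
      ((∃ δ' : ℝ, 0 < δ' ∧ ∀ (R R' : ℕ) (A : QCDLatticeObservable Nf R) (B : QCDLatticeObservable Nf R'), (∃ (f₀ : Fin Nf) (q : ℤ), q ≠ 0 ∧ ∀ (θ : ℝ) (U : LGConfig 4 (Matrix.specialUnitaryGroup (Fin 3) ℂ)), ExteriorAlgebra.map (LinearMap.pi fun w => (Sum.elim (fun i => if (boxQuarkEquiv.symm i).1 = f₀ then Complex.exp (-((θ : ℂ) * Complex.I)) else 1) (fun i => if (boxQuarkEquiv.symm i).1 = f₀ then Complex.exp ((θ : ℂ) * Complex.I) else 1) (ofLex w)) • LinearMap.proj w) (A.F U) = Complex.exp (((q : ℝ) * θ : ℝ) * Complex.I) • A.F U) → ∃ C' : ℝ, ∀ᶠ k in atTop, ∀ S : ℕ, reg.L k ≤ S → ∀ n : ℕ, n ≤ S → ‖(∫ U : GaugeConfig 4 (2 * S + 1) (Matrix.specialUnitaryGroup (Fin 3) ℂ), (‖(diracMatrix U fun fl => reg.mcrit k + reg.a k * m fl / reg.Zm k).det‖ : ℂ) * (fermiIntegral (A.onTorus (2 * S + 1) 0 U * B.onTorus (2 * S + 1)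 (Pi.single 0 (n : ℤ)) U * fermiBoltzmann U fun fl => reg.mcrit k + reg.a k * m fl / reg.Zm k) / fermiIntegral (fermiBoltzmann U fun fl => reg.mcrit k + reg.a k * m fl / reg.Zm k)) ∂(wilsonMeasure (fundamentalRep (Fin 3)) (reg.β k))) / (∫ U : GaugeConfig 4 (2 * S + 1) (Matrix.specialUnitaryGroup (Fin 3) ℂ), (‖(diracMatrix U fun fl => reg.mcrit k + reg.a k * m fl / reg.Zm k).det‖ : ℂ) ∂(wilsonMeasure (fundamentalRep (Fin 3)) (reg.β k)))‖ ≤ C' * Real.exp (-(δ' * (reg.a k * n)))) ↔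
        (∀ (R R' : ℕ) (A : QCDLatticeObservable Nf R) (B : QCDLatticeObservable Nf R'), (∃ (f₀ : Fin Nf) (q : ℤ), q ≠ 0 ∧ ∀ (θ : ℝ) (U : LGConfig 4 (Matrix.specialUnitaryGroup (Fin 3) ℂ)), ExteriorAlgebra.map (LinearMap.pi fun w => (Sum.elim (fun i => if (boxQuarkEquiv.symm i).1 = f₀ then Complex.exp (-((θ : ℂ) * Complex.I)) else 1) (fun i => if (boxQuarkEquiv.symm i).1 = f₀ then Complex.exp ((θ : ℂ) * Complex.I) else 1) (ofLex w)) • LinearMap.proj w) (A.F U) = Complex.exp (((q : ℝ) * θ : ℝ) * Complex.I) • A.F U) → ∃ C' μ' : ℝ, 0 < μ' ∧ ∃ S₀ : ℕ, ∀ S : ℕ, S₀ ≤ S → ∀ n : ℕ, n ≤ S → ‖(∫ U : GaugeConfig 4 (2 * S + 1) (Matrix.specialUnitaryGroup (Fin 3) ℂ), (‖(diracMatrix U fun fl => c + lam * m fl).det‖ : ℂ) * (fermiIntegral (A.onTorus (2 * S + 1) 0 U * B.onTorus (2 * S + 1) (Pi.single 0 (n : ℤ)) U * fermiBoltzmann U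 fun fl => c + lam * m fl) / fermiIntegral (fermiBoltzmann U fun fl => c + lam * m fl)) ∂(wilsonMeasure (fundamentalRep (Fin 3)) β)) / (∫ U : GaugeConfig 4 (2 * S + 1) (Matrix.specialUnitaryGroup (Fin 3) ℂ), (‖(diracMatrix U fun fl => c + lam * m fl).det‖ : ℂ) ∂(wilsonMeasure (fundamentalRep (Fin 3)) β))‖ ≤ C' * Real.exp (-(μ' * n)))) := by
  intro Nf reg m β c lam h1 h2 h3
  refine conc_core reg _ _ _ fun k R R' A B S n => ?_
  rw [h1 k, mq_const_eq reg m c lam h2 h3 k]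

end Summit.QuantumFields.QCD.Cruxes.PhaseQuenchedFlavourDecay.CrossingSplitIntegrability
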